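import Summits.HodgeConjecture.HodgeConjecture.Theorems.Ring2HypothesesDescentAbsolutePrimitiveMiddleSix
import Summits.HodgeConjecture.HodgeConjecture.Theorems.Ring2HypothesesDescentAbsolutePrimitiveDefect
import Summits.HodgeConjecture.HodgeConjecture.Theorems.Ring2AbelianAllSpreadPrimitiveMiddleSix
import HarnessLib

/-!
# Ring 2 — hypotheses layer, descent axis: the Lefschetz DEFECT is a free parameter already for HODGE classes — `HC_AV ↔`
# "θ-primitive rational `(q,q)`-classes on abelian `(2q + k)`-folds are algebraic" for EVERY `k` (FACT-FREE), and ROW b06's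
# primitive-defect / sixfold forms hold modulo Deligne's theorem (c1) ALONE

HONEST FRAMING (page 1, verbatim the cell's standing line): **research route conditional on HC_CM; not a
corollary; Q11.4-sentence-2 already refuted in dim ≥ 3.** Nothing in this file proves a case of the Hodge conjecture;
nothing discharges the binder of record b06 `Ring2.Hypotheses.AbsoluteHodgeImpliesAlgebraicAV` (`Ring2HypothesesDescent.lean` :73;
OPEN, `≡ HC_AV` modulo c1); the binder table's numbers do not move. `HC_CM` (`Theses.RankFourFaces.CMAbelianHodge`) does not occur in
this file; `HC_AV`, `HCAtDim 4` occur only inside equivalences / as hypotheses and are never asserted.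

Hodge ladder STAGE 3, `BINDER-OWNERS.md` row **b06**, seat `ring2-b06` (gen 72), eighth file of the gen — the "second road" of the third
and fourth files (`Ring2HypothesesDescentAbsolutePrimitiveDefect`: defect `k` forms modulo (N)+(E)+(c);
`Ring2HypothesesDescentAbsolutePrimitiveMiddleSix`: the sixfold layer granted `HCAtDim 4`). For RATIONAL `(p,p)`-classes the bare pull-back
`pr_X^* c` to `X × E` is rational of type `(p,p)` (fact-free) and, by the third file's `map_fst_mem_primitiveClasses_boxSum_of_sq_eq_zero`,
primitive of one defect MORE for the exterior-sum polarisation; the slice descends algebraicity (ring2-b02). So the defect of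
AbelianAll XXVIII's primitive-middle normal form (`HC_AV_iff_forall_isPolarizationClass_primitiveMiddle`, defect `0`, fact-free, count
once ab-spread-1's) can be raised to any `k`:

* §1 `hodge_primitive_algebraic_abelian_of_add_defect` — UP in defect by bare pull-backs, inside abelian varieties (transport along
  `A.X ≅ X` as in XXVIII), fact-free.
* §2 **`HC_AV_iff_primitive_defect k` — FACT-FREE: `HC_AV ↔` "for every complex abelian variety `B`, every polarisation class `θ` and
  every `q ≥ 2` with `dim B = 2q + k`, every θ-PRIMITIVE rational `(q,q)`-class in `H^{2q}(B(ℂ); ℂ)` is algebraic"**, for EVERY `k`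
  (`k = 0` is XXVIII).
* §3 MODULI NESTED: granted Deligne's Main Theorem 2.11 (c1) alone — `absoluteHodgeImpliesAlgebraicAV_iff_primitive_defect_of_deligne k`
  (the third file's row-b06 defect form on the c1 road) and `absoluteHodgeImpliesAlgebraicAV_iff_primitiveMiddle_ge_three_of_deligne_of_hcAtDim_four`
  (the fourth file's sixfold form on the c1 road = AbelianAll XXIX `HC_AV_iff_primitiveMiddle_ge_three_of_hcAtDim_four` read on
  absolute Hodge classes). The binder is the same on both roads.

HONEST COLUMN. Nothing is discharged; «10 · 0» unchanged; `HC_AV`, row b06, `HCAtDim 4` NOT asserted; c1 displayed as a hypothesis in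
§3; §1–§2 fact-free (closures: the three standard axioms); no definition, no named fact, no sorry. NOT claimed: the analogue for the
summit statement `HodgeConjecture` (its primitive-middle form `hodgeConjecture_iff_hodgePrimitiveMiddle` lives on another route's
carrier `HodgeModel`; not re-keyed here).

References (bib keys): Deligne1982HodgeCycles (Main Thm. 2.11, §2 Ex. 2.1), CharlesSchnell2014Notes (Def. 11.2.3), VoisinHodgeI2002
(§6.2.3 Def. 6.24, Thm. 6.25, Cor. 6.26, Rem. 6.27, §7.3.2), Kleiman1968AlgebraicCycles (§1.4 (1.4.6), Thm. 2.9), KerrPearlstein2011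
(§3.1, §3.3), BrosnanFangNiePearlstein2009 (§6 Lemma 48), Fulton1998 (§10.1 Cor. 10.1), MumfordAV1970 (§1), SilvermanAEC2009 (III.3.6),
MoonenZarhin1999 (Thm. 0.1), Deligne2000 (§1). -/

noncomputable section

set_option linter.dupNamespace false

open CategoryTheory AlgebraicGeometry MonoidalCategory CartesianMonoidalCategory
open Literature.AlgebraicTopology.SingularHomology Literature.Geometry.Kaehler
open Literature.AlgebraicGeometry Literature.AlgebraicGeometry.Motives
open Literature.AlgebraicGeometry.HodgeTheory
open Summit.HodgeConjecture.HodgeConjecture.Theorems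
open Summit.HodgeConjecture.HodgeConjecture.Theses.PadicSemiregularLift (HodgeAbelianVarieties)
open Summit.HodgeConjecture.HodgeConjecture.Ring2.ClassTargets (HCAtDim)
open Summit.HodgeConjecture.HodgeConjecture.Ring2.Binders (map_mem_primitiveClasses mem_algebraicClasses_of_map_fst_mem)

namespace Summit.HodgeConjecture.HodgeConjecture.Ring2.Hypotheses

/-! ## §1 Raising the defect of a primitive Hodge class by bare pull-backs, inside abelian varieties (fact-free) -/

section Induction

/-- **ABELIAN, UP TO DEFECT `d + e` FROM DEFECT `d`, FOR RATIONAL `(p,p)`-CLASSES** (fact-free): if on every complex abelian variety `B`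
and for every polarisation class `θ` every θ-primitive rational `(q,q)`-class of codimension `q ≥ 2` and defect exactly `d + e` is
algebraic, then so is every η-primitive rational `(p,p)`-class of codimension `p ≥ 2` and defect `d` on every smooth projective `X ≅ A.X`
(`A` abelian) — `e` bare pull-backs to `X × E` (`E` an elliptic curve: rational and `(p,p)` by `IsRationalClass.map` /
`IsOfHodgeType.map_of_isSmoothProjective`, primitive of one defect more by `map_fst_mem_primitiveClasses_boxSum_of_sq_eq_zero`,
`κ ∪ κ = 0`), the slice descending algebraicity (ring2-b02's `mem_algebraicClasses_of_map_fst_mem`); base case by transport along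
`A.X ≅ X`. The hypothesis is NOT asserted. [cite: VoisinHodgeI2002, §6.2.3 Def. 6.24, Cor. 6.26 and §7.3.2]
[cite: Kleiman1968AlgebraicCycles, §1.4 (1.4.6) and Thm. 2.9] [cite: Fulton1998, §10.1 Cor. 10.1] [cite: MumfordAV1970, §1] -/
theorem hodge_primitive_algebraic_abelian_of_add_defect (d : ℕ) :
    ∀ (e : ℕ), (∀ (B : AbelianVariety ℂ) ⦃θ : complexBetti B.X 2⦄, IsPolarizationClass B.dim B.X θ →
        ∀ q : ℕ, 2 ≤ q → 2 * q + (d + e) = B.dim → ∀ z : complexBetti B.X (2 * q), IsRationalClass z →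
          IsOfHodgeType B.dim B.X (2 * q) q q z → z ∈ primitiveClasses θ B.dim (2 * q) → z ∈ algebraicClasses B.X q) →
      ∀ {X : SchemeOver ℂ} {n : ℕ}, IsSmoothProjective n X → ∀ (A : AbelianVariety ℂ), A.dim = n → (A.X ≅ X) →
        ∀ {η : complexBetti X 2}, IsPolarizationClass n X η → ∀ {p : ℕ}, 2 ≤ p → 2 * p + d = n →
          ∀ (c : complexBetti X (2 * p)), IsRationalClass c → IsOfHodgeType n X (2 * p) p p c →
            c ∈ primitiveClasses η n (2 * p) → c ∈ algebraicClasses X p := by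
  intro e
  induction e generalizing d with
  | zero =>
    intro hk X n hX A hA eA η hη p h2 hn c hc hpp hprim
    subst hA
    have hAX : IsSmoothProjective A.dim A.X := AbelianVariety.isSmoothProjective_holds
    have hz := hk A (hη.map_of_iso hX hAX eA) p h2 (by omega) (complexBetti.map eA.hom (2 * p) c)
      (hc.map (AlgPoints.mapContinuous (L := ℂ) eA.hom)) (hpp.map_of_isSmoothProjective hAX hX eA.hom)
      (map_mem_primitiveClasses eA.hom hprim)
    exact (mem_algebraicClasses_map_iff_of_iso eA).1 hz
  | succ r ih =>
    intro hk X n hX A hA eA η hη p h2 hn c hc hpp hprim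
    obtain ⟨E, hE1⟩ := exists_abelianVariety_dim_eq_one ℂ
    have hE : IsSmoothProjective E.dim E.X := AbelianVariety.isSmoothProjective_holds
    obtain ⟨κ, hκ⟩ := exists_isPolarizationClass hE
    have hX' : IsSmoothProjective (n + E.dim) (X ⊗ E.X) := IsSmoothProjective.tensor_holds hX hE
    have hA' : (A.prod E).dim = n + E.dim := by rw [AbelianVariety.dim_prod, hA]
    have hκκ : cupProduct (rfl : 2 + 2 = 4) κ κ = 0 := by
      haveI := subsingleton_complexBetti hE (k := 4) (by omega)
      exact Subsingleton.elim _ _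
    refine mem_algebraicClasses_of_map_fst_mem hX E (ih (d + 1) (fun B θ hθ q hq hqB ↦ hk B hθ q hq (by omega)) hX'
      (A.prod E) hA' (whiskerRightIso eA E.X) (isPolarizationClass_boxSum hX hE hη hκ) h2 (by omega) _
      (hc.map (AlgPoints.mapContinuous (L := ℂ) (fst X E.X))) (hpp.map_of_isSmoothProjective hX' hX (fst X E.X))
      (map_fst_mem_primitiveClasses_boxSum_of_sq_eq_zero η hκκ (by omega) hprim))

end Induction

/-! ## §2 `HC_AV` at every fixed primitive defect (fact-free) -/

section HCAV

/-- **`HC_AV ↔` "for every complex abelian variety `B`, every polarisation class `θ` and every `q ≥ 2` with `dim B = 2q + k`, every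
θ-PRIMITIVE rational `(q,q)`-class in `H^{2q}(B(ℂ); ℂ)` is algebraic" — EVERY `k`, FACT-FREE.** `⟹` restriction; `⟸`: AbelianAll
XXVIII's primitive-MIDDLE normal form (`HC_AV_iff_forall_isPolarizationClass_primitiveMiddle`, defect `0`) follows by raising the defect
from `0` to `k` (§1 with `d = 0`, `e = k`, `X = A.X`). Neither side is asserted. [cite: KerrPearlstein2011, §3.1 and §3.3]
[cite: VoisinHodgeI2002, §6.2.3 Def. 6.24, Thm. 6.25 and Cor. 6.26] [cite: BrosnanFangNiePearlstein2009, §6 Lemma 48] -/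
theorem HC_AV_iff_primitive_defect (k : ℕ) :
    HodgeAbelianVarieties ↔
      ∀ (B : AbelianVariety ℂ) ⦃θ : complexBetti B.X 2⦄, IsPolarizationClass B.dim B.X θ →
        ∀ q : ℕ, 2 ≤ q → 2 * q + k = B.dim → ∀ z : complexBetti B.X (2 * q), IsRationalClass z →
          IsOfHodgeType B.dim B.X (2 * q) q q z → z ∈ primitiveClasses θ B.dim (2 * q) → z ∈ algebraicClasses B.X q := by
  refine ⟨fun h B θ _ q _ _ z hz hqq _ ↦ (h B).2 q z hz hqq,
    fun h ↦ AbelianAll.HC_AV_iff_forall_isPolarizationClass_primitiveMiddle.2 ?_⟩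
  intro A m hm hA θ hθ c hc hmm hprim
  exact hodge_primitive_algebraic_abelian_of_add_defect 0 k (fun B θ' hθ' q hq hqB ↦ h B hθ' q hq (by omega))
    (AbelianVariety.isSmoothProjective_holds (A := A)) A rfl (Iso.refl A.X) hθ hm (by omega) c hc hmm hprim

/-- **The `¬`-form: a counterexample to `HC_AV`, if any, can be taken θ-primitive of codimension `q` on an abelian variety of dimension
EXACTLY `2q + k`, for any `k` fixed in advance** (fact-free). Neither side is asserted. [cite: KerrPearlstein2011, §3.1 and §3.3]
[cite: VoisinHodgeI2002, §6.2.3 Def. 6.24 and Thm. 6.25] -/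
theorem not_HC_AV_iff_exists_primitive_defect_not_mem (k : ℕ) :
    ¬ HodgeAbelianVarieties ↔
      ∃ (B : AbelianVariety ℂ) (θ : complexBetti B.X 2), IsPolarizationClass B.dim B.X θ ∧
        ∃ q : ℕ, 2 ≤ q ∧ 2 * q + k = B.dim ∧ ∃ z : complexBetti B.X (2 * q), IsRationalClass z ∧
          IsOfHodgeType B.dim B.X (2 * q) q q z ∧ z ∈ primitiveClasses θ B.dim (2 * q) ∧ z ∉ algebraicClasses B.X q := by
  rw [HC_AV_iff_primitive_defect k]
  push Not
  exact Iff.rfl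

end HCAV

/-! ## §3 Moduli nested: row b06's primitive forms modulo Deligne's theorem (c1) alone -/

section Deligne

/-- **Granted Deligne's Main Theorem 2.11 (c1) instead of (N)+(E)+(c): ROW b06 `↔` "θ-primitive absolute Hodge classes of codimension
`q ≥ 2` on complex abelian `(2q + k)`-folds are algebraic", every `k`** — under c1 "absolute Hodge" = "rational `(p,p)`" on abelian
varieties, row b06 `↔ HC_AV` (`hc_av_iff_absoluteHodgeImpliesAlgebraicAV_of_deligne`), and `HC_AV` has the fact-free defect-`k` form of §2.
The binder is the same as on the (N)+(E)+(c) road (the third file's `absoluteHodgeImpliesAlgebraicAV_iff_primitive_defect_of_canonical`);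
c1 is NOT asserted. [cite: Deligne1982HodgeCycles, Main Thm. 2.11 (p. 19)] [cite: CharlesSchnell2014Notes, Def. 11.2.3]
[cite: KerrPearlstein2011, §3.1 and §3.3] -/
theorem absoluteHodgeImpliesAlgebraicAV_iff_primitive_defect_of_deligne (hD : deligne1982_hodgeClasses_abelianVariety_absoluteHodge)
    (k : ℕ) :
    AbsoluteHodgeImpliesAlgebraicAV ↔
      ∀ (B : AbelianVariety ℂ) ⦃θ : complexBetti B.X 2⦄, IsPolarizationClass B.dim B.X θ →
        ∀ q : ℕ, 2 ≤ q → 2 * q + k = B.dim → ∀ z : complexBetti B.X (2 * q), IsAbsoluteHodgeClass B.dim B.X q z →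
          z ∈ primitiveClasses θ B.dim (2 * q) → z ∈ algebraicClasses B.X q := by
  refine ⟨fun h B θ _ q _ _ z hz _ ↦ h B q z hz, fun h ↦ ?_⟩
  rw [← hc_av_iff_absoluteHodgeImpliesAlgebraicAV_of_deligne hD]
  exact (HC_AV_iff_primitive_defect k).2 fun B θ hθ q hq hqB z hz hqq hprim ↦ h B hθ q hq hqB z (hD B q z hz hqq) hprim

/-- **Granted c1 and `HCAtDim 4`: ROW b06 `↔` its primitive-middle form FROM THE SIXFOLDS ON** — AbelianAll XXIX
(`HC_AV_iff_primitiveMiddle_ge_three_of_hcAtDim_four`, count once ab-spread-1's) read on absolute Hodge classes: the fourth file's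
`absoluteHodgeImpliesAlgebraicAV_iff_primitiveMiddle_ge_three_of_hcAtDim_four` on the c1 road. c1, `HCAtDim 4` and row b06 are NOT
asserted. [cite: Deligne1982HodgeCycles, Main Thm. 2.11 (p. 19)] [cite: MoonenZarhin1999, Thm. 0.1] [cite: KerrPearlstein2011, §3.3]
[cite: Deligne2000, §1] -/
theorem absoluteHodgeImpliesAlgebraicAV_iff_primitiveMiddle_ge_three_of_deligne_of_hcAtDim_four
    (hD : deligne1982_hodgeClasses_abelianVariety_absoluteHodge) (h4 : HCAtDim 4) :
    AbsoluteHodgeImpliesAlgebraicAV ↔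
      ∀ (A : AbelianVariety ℂ) (Λ : HardLefschetzNFold A.dim A.X) (m : ℕ), 3 ≤ m → A.dim = 2 * m →
        ∀ c : complexBetti A.X (2 * m), IsAbsoluteHodgeClass A.dim A.X m c →
          c ∈ primitiveClasses Λ.hyperplaneClass A.dim (2 * m) → c ∈ algebraicClasses A.X m := by
  refine ⟨fun h A _ m _ _ c hc _ ↦ h A m c hc, fun h ↦ ?_⟩
  rw [← hc_av_iff_absoluteHodgeImpliesAlgebraicAV_of_deligne hD]
  exact (AbelianAll.HC_AV_iff_primitiveMiddle_ge_three_of_hcAtDim_four h4).2 fun A Λ m h2 h3 hA c hc hpp hprim ↦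
    h A Λ m h3 hA c (hD A m c hc hpp) hprim

end Deligne

/-! ## Audit: nothing is decided here

§1–§2 are fact-free (closures: the three standard axioms); §3 carries the undischarged hypotheses c1 (and `HCAtDim 4`). No theorem
concludes `HC_AV`, `AbsoluteHodgeImpliesAlgebraicAV`, `HCAtDim 4` or `HC_CM` outright. -/

#print axioms Summit.HodgeConjecture.HodgeConjecture.Ring2.Hypotheses.HC_AV_iff_primitive_defect
#print axioms Summit.HodgeConjecture.HodgeConjecture.Ring2.Hypotheses.absoluteHodgeImpliesAlgebraicAV_iff_primitive_defect_of_deligne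

end Summit.HodgeConjecture.HodgeConjecture.Ring2.Hypotheses

end
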